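import Summits.ValiantsHypothesis.ValiantsHypothesis.Theorems.KPlusLogSqLawTropicalBIntervalOptDefs
import Summits.ValiantsHypothesis.ValiantsHypothesis.Theorems.KPlusLogSqLawTropicalBLatticeChain

/-!
# Route «KPlusLogSqLaw», crux `TropicalB` (stmt-ValiantsHypothesis-19771) — NEWTON-POLYGON VERTEX BOUNDS for dominant chains:
# the valuation-spread law and Jarník's two-thirds law (uniform in the number `K` of slope classes)

HONEST FRAMING.  Helper lemmas toward the registered stub `stub_tropThin` of `Cruxes/TropicalB/Lines/birth.lean` (crux
`Summit.ValiantsHypothesis.ValiantsHypothesis.Theses.KPlusLogSqLaw.TropicalB`, item `stmt-ValiantsHypothesis-19771`, route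
`KPlusLogSqLaw`, DRAFT; cell `pub-symmetroid`, seat val-sym-trop-p1, docket «slope-count / Newton-polygon vertex bound»).  They do
NOT prove the stub (which is equivalent to `TropicalB` itself, `thinStub_iff_tropicalB`, and OPEN): they are `K`-FREE upper bounds
on the length `n` of a dominant chain of a dominance design `(d, v, ε)` of format `(m, K)` in terms of the SIZE of its data,
complementing the exponent-spread law `chain_le_mul_spread` (`n ≤ m·(D₁ − D₀)`, file `KPlusLogSqLawTropicalBThinRanges`):

* `NewtonPolygon.chain_le_valSpread` — **valuation-spread law**: if `V₀ ≤ v ≤ V₁` entrywise then `n ≤ 2·m·(V₁ − V₀) + 1`;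
* `NewtonPolygon.chain_cube_le` — **Jarník's two-thirds law**: if moreover `D₀ ≤ d ≤ D₁` then
  `n³ ≤ 24·(m·(D₁ − D₀) + 2·m·(V₁ − V₀))²`, i.e. `n ≤ 24^{1/3}·(m(D₁ − D₀) + 2m(V₁ − V₀))^{2/3}`;
* `NewtonPolygon.logSqLaw_of_boundedVal` — corollary in the currency of the stub: on every design whose valuations satisfy
  `|v| ≤ 2^{c·⌊log₂ m⌋²}`, a sign-alternating dominant chain has `n ≤ 2^{(c+1)·⌊log₂ m⌋² + 3}` — the `log² m` law with `C = c + 1`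
  for EVERY `K` (in particular the thin stub's inequality on that sub-class of designs, with no hypothesis on `K`).

MECHANISM (the Newton polygon; `K` never enters).  Along a dominant chain `p₀, …, pₙ` at integer slopes `θ₀ < ⋯ < θₙ` the lattice
points `(sₖ, cₖ) = (Σᵢ d(λₖ i), Σᵢ v(σₖ i, i, λₖ i)) ∈ ℤ²` (in the tree's `IntervalOpt.sl` / `IntervalOpt.cst` on all columns) are
consecutive vertices of a convex lattice polygon — the Newton polygon of the tropical determinant: dominance of `pₖ` at `θₖ` over
`pₖ₊₁` and of `pₖ₊₁` at `θₖ₊₁` over `pₖ` is the SANDWICH `θₖ·Δsₖ < Δcₖ < θₖ₊₁·Δsₖ` (`NewtonPolygon.sandwich`); the companion file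
`KPlusLogSqLawTropicalBLatticeChain.lean` develops the consequences for an ABSTRACT sandwiched lattice chain `(Θ, S, C)`: `Δsₖ ≥ 1` (`step_pos`), the edge slopes strictly increase
(`cross_lt`), the edge vectors `(Δsₖ, Δcₖ)` are pairwise distinct (`edge_injOn`), and falling edges precede rising ones
(`rise_after`).  Hence (i) at most one edge is horizontal and the others move `c` by `≥ 1` down then up inside an interval of
length `B₁ − B₀`: `n ≤ 2(B₁ − B₀) + 1` and `Σ |Δc| ≤ 2(B₁ − B₀)` (`val_budget`); (ii) the `ℓ¹`-perimeter `Σₖ (Δsₖ + |Δcₖ|)` is at most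
`P = (A₁ − A₀) + 2(B₁ − B₀)` (`perimeter_le`), while at most `t(2t+1)` pairwise distinct lattice vectors with positive abscissa have
`ℓ¹`-size `≤ t` (`small_card_le`), so `(t+1)(n − t(2t+1)) ≤ P` for every `t` (`key_ineq`), and `t = ⌊√(n/6)⌋` gives `n³ ≤ 24 P²`
(`cube_le_perimeter_sq`).  [folklore: V. Jarník, Über die Gitterpunkte auf konvexen Kurven, Math. Z. 24 (1926) 500–518;
G. E. Andrews, A lower bound for the volume of strictly convex bodies with many boundary lattice points, Trans. AMS 106 (1963).]

READING FOR THE CRUX (a located necessary condition on hypothetical counterexamples, not a statement about `TropicalB`): a family of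
designs violating the thin law in the window `log₂ m + 1 < K ≤ log₂² m` must carry, for every `c`, BOTH an exponent of size
`> 2^{c·log₂² m}/m` (`chain_le_mul_spread`) AND a valuation of absolute size `> 2^{c·log₂² m}` (`chain_le_valSpread`) eventually, and
`max(exponent spread, valuation spread) ≥ n^{3/2}/(15·m)` (`chain_cube_le`); designs with quasi-polynomially bounded data obey the
`log² m` law for every `K` by (i) alone.  (Calibration: the counting-tight `K = 3` family SHIFT-THREE, `n = C(m+2,2) − 2`, has
exponent spread `m(2m+3)` and valuation spread `Θ(m⁴)`; the laws above then allow `n = O(m³)` resp. `O(m^{10/3})` — not tight.)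
Nothing here bears on `TropicalB` / `KPlusLogSqLaw` in the window, on `Lifting`, on the cell's registers (DoorA26 / DoorA34), on
`MatrixDescartes` (`stmt-ValiantsHypothesis-18050`) or on VP ≠ VNP.
-/

-- `Summit.ValiantsHypothesis.ValiantsHypothesis.…` repeats a component by the D-0017 layout
-- (single-conjunct summit), which the `dupNamespace` linter flags; the name is mandated.
set_option linter.dupNamespace false
set_option autoImplicit false

namespace Summit.ValiantsHypothesis.ValiantsHypothesis.Theorems.KPlusLogSqLaw

open Summit.ValiantsHypothesis.ValiantsHypothesis.Theorems.MatrixDescartes.Negative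
open scoped BigOperators
open Finset

namespace NewtonPolygon

variable {m K : ℕ}

/-! ## 1. One pair of dominant terms: the slope sandwich -/

section Pair

variable (d : Fin K → ℕ) (v ε : Fin m → Fin m → Fin K → ℤ)

/-- The tropical weight is `θ·(slope) − (valuation sum)`, with the all-columns `IntervalOpt.sl` / `IntervalOpt.cst`. [folklore] -/
theorem tropWeight_eq_sl_sub_cst (θ : ℤ) (p : Equiv.Perm (Fin m) × (Fin m → Fin K)) :
    tropWeight d v θ p = θ * IntervalOpt.sl d univ p - IntervalOpt.cst v univ p := rfl

/-- Upper half of the sandwich: if `q` is dominant at `θ` and `p ≠ q` is present, then `cst q − cst p < θ·(sl q − sl p)`. [folklore] -/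
theorem cst_sub_lt_of_dominant {θ : ℤ} {p q : Equiv.Perm (Fin m) × (Fin m → Fin K)}
    (hq : IsDominant d v ε θ q) (hp : termSign ε p ≠ 0) (hne : p ≠ q) :
    IntervalOpt.cst v univ q - IntervalOpt.cst v univ p <
      θ * (IntervalOpt.sl d univ q - IntervalOpt.sl d univ p) := by
  have h := hq.2 p hne hp
  rw [tropWeight_eq_sl_sub_cst, tropWeight_eq_sl_sub_cst] at h
  linarith

/-- Lower half of the sandwich: if `p` is dominant at `θ` and `q ≠ p` is present, then `θ·(sl q − sl p) < cst q − cst p`. [folklore] -/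
theorem lt_cst_sub_of_dominant {θ : ℤ} {p q : Equiv.Perm (Fin m) × (Fin m → Fin K)}
    (hp : IsDominant d v ε θ p) (hq : termSign ε q ≠ 0) (hne : q ≠ p) :
    θ * (IntervalOpt.sl d univ q - IntervalOpt.sl d univ p) <
      IntervalOpt.cst v univ q - IntervalOpt.cst v univ p := by
  have h := hp.2 q hne hq
  rw [tropWeight_eq_sl_sub_cst, tropWeight_eq_sl_sub_cst] at h
  linarith

/-- The slope of a term lies in `[m·D₀, m·D₁]` when every exponent lies in `[D₀, D₁]`. [folklore] -/
theorem sl_mem_of_bounds (D₀ D₁ : ℕ) (hd : ∀ l, D₀ ≤ d l ∧ d l ≤ D₁) (p : Equiv.Perm (Fin m) × (Fin m → Fin K)) :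
    (m : ℤ) * D₀ ≤ IntervalOpt.sl d univ p ∧ IntervalOpt.sl d univ p ≤ (m : ℤ) * D₁ := by
  unfold IntervalOpt.sl
  constructor
  · have h := Finset.card_nsmul_le_sum (univ : Finset (Fin m)) (fun i => (d (p.2 i) : ℤ)) (D₀ : ℤ)
      (fun i _ => by exact_mod_cast (hd (p.2 i)).1)
    rwa [card_univ, Fintype.card_fin, nsmul_eq_mul] at h
  · have h := Finset.sum_le_card_nsmul (univ : Finset (Fin m)) (fun i => (d (p.2 i) : ℤ)) (D₁ : ℤ)
      (fun i _ => by exact_mod_cast (hd (p.2 i)).2)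
    rwa [card_univ, Fintype.card_fin, nsmul_eq_mul] at h

/-- The valuation sum of a term lies in `[m·V₀, m·V₁]` when every valuation lies in `[V₀, V₁]`. [folklore] -/
theorem cst_mem_of_bounds (V₀ V₁ : ℤ) (hv : ∀ i j l, V₀ ≤ v i j l ∧ v i j l ≤ V₁)
    (p : Equiv.Perm (Fin m) × (Fin m → Fin K)) :
    (m : ℤ) * V₀ ≤ IntervalOpt.cst v univ p ∧ IntervalOpt.cst v univ p ≤ (m : ℤ) * V₁ := by
  unfold IntervalOpt.cst
  constructor
  · have h := Finset.card_nsmul_le_sum (univ : Finset (Fin m)) (fun i => v (p.1 i) i (p.2 i)) V₀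
      (fun i _ => (hv _ _ _).1)
    rwa [card_univ, Fintype.card_fin, nsmul_eq_mul] at h
  · have h := Finset.sum_le_card_nsmul (univ : Finset (Fin m)) (fun i => v (p.1 i) i (p.2 i)) V₁
      (fun i _ => (hv _ _ _).2)
    rwa [card_univ, Fintype.card_fin, nsmul_eq_mul] at h

end Pair

/-! ## 2. Dominant chains of a design -/

section Design

variable (d : Fin K → ℕ) (v ε : Fin m → Fin m → Fin K → ℤ)

/-- Re-index a `Fin (n+1)`-chain of dominant terms by `ℕ` (freezing the last index). [folklore] -/
theorem exists_natChain (n : ℕ) (θ : Fin (n + 1) → ℤ) (p : Fin (n + 1) → Equiv.Perm (Fin m) × (Fin m → Fin K))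
    (hθ : StrictMono θ) (hdom : ∀ k, IsDominant d v ε (θ k) (p k)) (hne : ∀ k : Fin n, p k.castSucc ≠ p k.succ) :
    ∃ (Θ : ℕ → ℤ) (P : ℕ → Equiv.Perm (Fin m) × (Fin m → Fin K)),
      (∀ i, i < n → Θ i < Θ (i + 1)) ∧ (∀ i, i ≤ n → IsDominant d v ε (Θ i) (P i)) ∧
      (∀ i, i < n → P i ≠ P (i + 1)) := by
  refine ⟨fun i => θ ⟨min i n, by omega⟩, fun i => p ⟨min i n, by omega⟩, ?_, fun i _ => hdom _, ?_⟩
  · intro i hi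
    apply hθ
    rw [Fin.mk_lt_mk]
    omega
  · intro i hi h
    apply hne ⟨i, hi⟩
    have e1 : (⟨i, hi⟩ : Fin n).castSucc = ⟨min i n, by omega⟩ := Fin.ext (by simp [Nat.min_eq_left hi.le])
    have e2 : (⟨i, hi⟩ : Fin n).succ = ⟨min (i + 1) n, by omega⟩ :=
      Fin.ext (by simp [Nat.min_eq_left (Nat.succ_le_of_lt hi)])
    rw [e1, e2]
    exact h

/-- **The sandwich along a dominant chain**: `Θ i · Δsl < Δcst < Θ (i+1) · Δsl` for every step (each of two consecutive
dominant terms beats the other at its own slope). [folklore] -/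
theorem sandwich {n : ℕ} {Θ : ℕ → ℤ} {P : ℕ → Equiv.Perm (Fin m) × (Fin m → Fin K)}
    (hdom : ∀ i, i ≤ n → IsDominant d v ε (Θ i) (P i)) (hne : ∀ i, i < n → P i ≠ P (i + 1))
    {i : ℕ} (hi : i < n) :
    Θ i * (IntervalOpt.sl d univ (P (i + 1)) - IntervalOpt.sl d univ (P i)) <
        IntervalOpt.cst v univ (P (i + 1)) - IntervalOpt.cst v univ (P i) ∧
      IntervalOpt.cst v univ (P (i + 1)) - IntervalOpt.cst v univ (P i) <
        Θ (i + 1) * (IntervalOpt.sl d univ (P (i + 1)) - IntervalOpt.sl d univ (P i)) :=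
  ⟨lt_cst_sub_of_dominant d v ε (hdom i hi.le) (hdom (i + 1) (Nat.succ_le_of_lt hi)).1 (hne i hi).symm,
    cst_sub_lt_of_dominant d v ε (hdom (i + 1) (Nat.succ_le_of_lt hi)) (hdom i hi.le).1 (hne i hi)⟩

/-- **Valuation-spread law** (`K`-free).  Along a chain of pairwise-consecutive-distinct dominant terms of a design whose
valuations all lie in `[V₀, V₁]`, the number of steps is at most `2·m·(V₁ − V₀) + 1`: the valuation sums `Σᵢ v(σᵢ, i, λᵢ)` are
integers in `[m V₀, m V₁]`, they first strictly decrease and then strictly increase along the chain, with at most one level step.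
Twin of the exponent-spread law `chain_le_mul_spread`. [folklore] -/
theorem chain_le_valSpread (V₀ V₁ : ℤ) (hv : ∀ i j l, V₀ ≤ v i j l ∧ v i j l ≤ V₁) {n : ℕ}
    (θ : Fin (n + 1) → ℤ) (p : Fin (n + 1) → Equiv.Perm (Fin m) × (Fin m → Fin K)) (hθ : StrictMono θ)
    (hdom : ∀ k, IsDominant d v ε (θ k) (p k)) (hne : ∀ k : Fin n, p k.castSucc ≠ p k.succ) :
    (n : ℤ) ≤ 2 * m * (V₁ - V₀) + 1 := by
  obtain ⟨Θ, P, hΘ, hdomN, hneN⟩ := exists_natChain d v ε n θ p hθ hdom hne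
  have h := (val_budget (S := fun i => IntervalOpt.sl d univ (P i)) (C := fun i => IntervalOpt.cst v univ (P i))
    hΘ (fun i hi => sandwich d v ε hdomN hneN hi) (B₀ := (m : ℤ) * V₀) (B₁ := (m : ℤ) * V₁)
    (fun i _ => cst_mem_of_bounds v V₀ V₁ hv (P i))).1
  linarith

/-- **Jarník's two-thirds law for dominant chains** (`K`-free).  Along a chain of pairwise-consecutive-distinct dominant terms of a
design with exponents in `[D₀, D₁]` and valuations in `[V₀, V₁]`, the number `n` of steps satisfies
`n³ ≤ 24·(m·(D₁ − D₀) + 2·m·(V₁ − V₀))²`: the points `(Σ d(λᵢ), Σ v(σᵢ,i,λᵢ))` of the chain are consecutive vertices of a convex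
lattice polygon of `ℓ¹`-perimeter `≤ m(D₁−D₀) + 2m(V₁−V₀)`, and a convex lattice polygon of perimeter `P` has `≤ (24 P²)^{1/3}`
vertices. [folklore: V. Jarník, Math. Z. 24 (1926) 500–518] -/
theorem chain_cube_le (D₀ D₁ : ℕ) (hd : ∀ l, D₀ ≤ d l ∧ d l ≤ D₁) (V₀ V₁ : ℤ) (hv : ∀ i j l, V₀ ≤ v i j l ∧ v i j l ≤ V₁)
    {n : ℕ} (θ : Fin (n + 1) → ℤ) (p : Fin (n + 1) → Equiv.Perm (Fin m) × (Fin m → Fin K)) (hθ : StrictMono θ)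
    (hdom : ∀ k, IsDominant d v ε (θ k) (p k)) (hne : ∀ k : Fin n, p k.castSucc ≠ p k.succ) :
    (n : ℤ) ^ 3 ≤ 24 * ((m : ℤ) * ((D₁ : ℤ) - D₀) + 2 * m * (V₁ - V₀)) ^ 2 := by
  obtain ⟨Θ, P, hΘ, hdomN, hneN⟩ := exists_natChain d v ε n θ p hθ hdom hne
  have hsw : ∀ i, i < n → Θ i * ((fun i => IntervalOpt.sl d univ (P i)) (i + 1) -
      (fun i => IntervalOpt.sl d univ (P i)) i) <
      (fun i => IntervalOpt.cst v univ (P i)) (i + 1) - (fun i => IntervalOpt.cst v univ (P i)) i ∧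
      (fun i => IntervalOpt.cst v univ (P i)) (i + 1) - (fun i => IntervalOpt.cst v univ (P i)) i <
      Θ (i + 1) * ((fun i => IntervalOpt.sl d univ (P i)) (i + 1) - (fun i => IntervalOpt.sl d univ (P i)) i) :=
    fun i hi => sandwich d v ε hdomN hneN hi
  have hcube := cube_le_perimeter_sq (S := fun i => IntervalOpt.sl d univ (P i))
    (C := fun i => IntervalOpt.cst v univ (P i)) hΘ hsw
  have hP0 := perimeter_nonneg (S := fun i => IntervalOpt.sl d univ (P i))
    (C := fun i => IntervalOpt.cst v univ (P i)) hΘ hsw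
  have hPle := perimeter_le (S := fun i => IntervalOpt.sl d univ (P i))
    (C := fun i => IntervalOpt.cst v univ (P i)) hΘ hsw (A₀ := (m : ℤ) * D₀) (A₁ := (m : ℤ) * D₁) (B₀ := (m : ℤ) * V₀) (B₁ := (m : ℤ) * V₁)
    (fun i _ => sl_mem_of_bounds d D₀ D₁ hd (P i)) (fun i _ => cst_mem_of_bounds v V₀ V₁ hv (P i))
  have hsq := pow_le_pow_left₀ hP0 hPle 2
  calc (n : ℤ) ^ 3 ≤ _ := hcube
    _ ≤ 24 * ((m : ℤ) * D₁ - m * D₀ + 2 * (m * V₁ - m * V₀)) ^ 2 := by linarith [hsq]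
    _ = 24 * ((m : ℤ) * ((D₁ : ℤ) - D₀) + 2 * m * (V₁ - V₀)) ^ 2 := by ring

/-- **The `log² m` law on valuation-bounded designs, for every `K`** (corollary of the valuation-spread law, in the currency of
the registered stub `stub_tropThin`): if every valuation of the design has absolute value `≤ 2^{c·⌊log₂ m⌋²}`, then every
sign-alternating chain of dominant terms at strictly increasing integer slopes has `n ≤ 2^{(c+1)·⌊log₂ m⌋² + 3}` — with NO
hypothesis on `K` (and none on `ε`).  So a counterexample to the thin law must carry valuations of super-quasi-polynomial size.
[folklore] -/
theorem logSqLaw_of_boundedVal (c : ℕ) (hv : ∀ i j l, (v i j l).natAbs ≤ 2 ^ (c * Nat.log 2 m ^ 2)) {n : ℕ}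
    (θ : Fin (n + 1) → ℤ) (p : Fin (n + 1) → Equiv.Perm (Fin m) × (Fin m → Fin K)) (hθ : StrictMono θ)
    (hdom : ∀ k, IsDominant d v ε (θ k) (p k))
    (halt : ∀ k : Fin n, termSign ε (p k.castSucc) * termSign ε (p k.succ) < 0) :
    n ≤ 2 ^ ((c + 1) * Nat.log 2 m ^ 2 + 3) := by
  -- consecutive terms are distinct (their signs multiply to a negative number)
  have hne : ∀ k : Fin n, p k.castSucc ≠ p k.succ := by
    intro k h
    have := halt k
    rw [h] at this
    exact absurd this (not_lt.mpr (mul_self_nonneg _))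
  set L := Nat.log 2 m with hL
  set V : ℕ := 2 ^ (c * L ^ 2) with hV
  have hv' : ∀ i j l, -(V : ℤ) ≤ v i j l ∧ v i j l ≤ V := by
    intro i j l
    have h : |v i j l| ≤ (V : ℤ) := by
      rw [Int.abs_eq_natAbs]
      exact_mod_cast hv i j l
    exact abs_le.1 h
  have h1 := chain_le_valSpread d v ε (-(V : ℤ)) V hv' θ p hθ hdom hne
  have h2 : (n : ℤ) ≤ ((4 * m * V + 1 : ℕ) : ℤ) := by push_cast; linarith
  have h3 : n ≤ 4 * m * V + 1 := by exact_mod_cast h2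
  have hm : m < 2 ^ (L + 1) := Nat.lt_pow_succ_log_self (by norm_num) m
  have hVpos : 1 ≤ V := Nat.one_le_two_pow
  have h4 : 4 * m + 4 ≤ 2 ^ (L + 3) := by
    have : 2 ^ (L + 3) = 2 ^ (L + 1) * 4 := by ring
    omega
  have h5 : 4 * m * V + 1 ≤ 2 ^ (L + 3) * V := by nlinarith [h4, hVpos]
  have h6 : 2 ^ (L + 3) * V = 2 ^ (L + 3 + c * L ^ 2) := by rw [hV, ← pow_add]
  have hLL : L ≤ L ^ 2 := Nat.le_self_pow two_ne_zero L
  have h7 : L + 3 + c * L ^ 2 ≤ (c + 1) * L ^ 2 + 3 := by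
    have : (c + 1) * L ^ 2 = c * L ^ 2 + L ^ 2 := by ring
    rw [this]
    omega
  calc n ≤ 4 * m * V + 1 := h3
    _ ≤ 2 ^ (L + 3) * V := h5
    _ = 2 ^ (L + 3 + c * L ^ 2) := h6
    _ ≤ 2 ^ ((c + 1) * L ^ 2 + 3) := Nat.pow_le_pow_right (by norm_num) h7

end Design

end NewtonPolygon

end Summit.ValiantsHypothesis.ValiantsHypothesis.Theorems.KPlusLogSqLaw
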